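import Summits.RiemannHypothesis.RiemannHypothesis.Theorems.PfPersistenceGalerkinClosedFormModulus
import Summits.RiemannHypothesis.RiemannHypothesis.Theorems.PfPersistenceGalerkinFormDensity
import Summits.RiemannHypothesis.RiemannHypothesis.Theorems.PfPersistenceGalerkinProfileDensity
import Summits.RiemannHypothesis.RiemannHypothesis.Theorems.PfPersistenceTallyTwin
import HarnessLib

/-!
# GAL — the Markov identity AT THE CUT-OFF, PROVED (`MarkovAtCutoff`, `GalerkinMatrixIdentity`)

File 3/3 of barrier-prover's second GAL route.  **Theorem** (`markovAtCutoff`): for every window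
`win = (a, N)` and every coefficient vector `v`,

  `Re Q(cutoffProfile win v) = P(G) + 𝓔_a(G) − M_a ‖G‖²`,  `G = cutoffProfile win v = 𝟙_{[-a,a]} θ_v`,

i.e. Bombieri's Markov closed form of Weil's quadratic functional holds at the (discontinuous)
cut-off Galerkin profiles themselves, not only at smooth tests supported in the window.  By the
typer's `markovAtCutoff_iff_galerkinMatrixIdentity` this is GAL-0 (i) `GalerkinMatrixIdentity` AS
TYPED (`Theorems/PfPersistenceGalerkinFormDomain.lean`), recorded here by name
(`galerkinMatrixIdentity`), and with the landed (ii′) `testToProfileFormDensity` the term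
`testToGalerkinFormDensity_of_markovAtCutoff markovAtCutoff testToProfileFormDensity` is a second,
Fejér-free proof of (ii″) `TestToGalerkinFormDensity` (not restated: already landed).

Proof.  Both sides are continuous along the two approximating families of the (ii) proof and
agree on smooth tests (Bombieri): (B) for `0 ≤ b < a` the mollifications `g_k = G_b ⋆ φ_k` of
`G_b = 𝟙_{[-b,b]} θ` are smooth tests supported in `[-a, a]` for large `k`, `Q(g_k) → W(A_b)`
(`weilQuadratic_weilConv_moll`, `tendsto_weilFunctional_mollSq`) and
`markovClosedForm a g_k → markovClosedForm a G_b` (closed-form engine: `g_k → G_b` in `L²`, jump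
forms uniformly linear), whence `Re W(A_b) = markovClosedForm a G_b`; (C) along the radii
`b_n ↑ a`, `W(A_{b_n}) → W(A_a)` (`tendsto_weilFunctional_autocorrAt`) and
`markovClosedForm a G_{b_n} → markovClosedForm a G_a` (engine again: `∫|G_{b_n} − G_a|² ≤ 2(a−b_n)M²`,
jump forms uniformly linear), whence the identity at `b = a`.

RH-free, data-free, no named facts.  Mechanism search only; no RH claims.
-/

set_option linter.dupNamespace false

noncomputable section

open Complex Filter Set MeasureTheory Topology
open scoped Real Convolution ComplexConjugate ContDiff

namespace Summit.RiemannHypothesis.RiemannHypothesis.Theorems.PfPersistence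

open Literature.NumberTheory.LFunctions Literature.NumberTheory.LFunctions.WeilContinuous
open Literature.NumberTheory.LFunctions.ConnesVanSuijlekom

namespace ClosedFormEngine

variable {f f' : ℝ → ℂ}

/-- `Φ_b(b) ≤ Φ_a(a)` for `0 ≤ b ≤ a`: the derivative mass grows with the window. [folklore] -/
theorem derivMass_self_mono (hf' : Continuous f') {b a : ℝ} (hb : 0 ≤ b) (hba : b ≤ a) :
    derivMass b f' b ≤ derivMass a f' a := by
  unfold derivMass
  exact intervalIntegral.integral_mono_interval (by linarith) (by linarith) hba
    (Eventually.of_forall fun _ ↦ norm_nonneg _) (intervalIntegrable_norm_deriv hf' _ _)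

/-- **Step (B): the identity one radius in.**  For `0 ≤ b < a`:
`Re W(A_b) = markovClosedForm a (G_b)`. [folklore] -/
theorem re_weilFunctional_autocorrAt_eq_markovClosedForm (hf : ∀ x, HasDerivAt f (f' x) x)
    (hf' : Continuous f') {b a : ℝ} (hb : 0 ≤ b) (hba : b < a) :
    (weilFunctional (autocorrAt b f)).re = markovClosedForm a (cutoffAt b f) := by
  have hfc : Continuous f := continuous_iff_continuousAt.2 fun x ↦ (hf x).continuousAt
  have hGm : Measurable (cutoffAt b f) := hfc.measurable.indicator measurableSet_Icc
  have hGi : Integrable (cutoffAt b f) := integrable_cutoffAt hfc b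
  have hGs : HasCompactSupport (cutoffAt b f) :=
    HasCompactSupport.intro isCompact_Icc fun x hx ↦ indicator_of_notMem hx f
  obtain ⟨M₀, hM₀⟩ := isCompact_Icc.exists_bound_of_continuousOn (s := Icc (-b) b) hfc.continuousOn
  have hM0 : 0 ≤ max M₀ 0 := le_max_right _ _
  have hM : ∀ x ∈ Icc (-b) b, ‖f x‖ ≤ max M₀ 0 := fun x hx ↦ (hM₀ x hx).trans (le_max_left _ _)
  have hGM : ∀ x, ‖cutoffAt b f x‖ ≤ max M₀ 0 := norm_cutoffAt_le_of_nonneg hM0 hM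
  have hGR : ∀ u : ℝ, b < |u| → cutoffAt b f u = 0 := fun u hu ↦ cutoffAt_eq_zero_of_lt b f hu
  -- (w) the Weil side: `Q(G_b ⋆ φ_k) → W(A_b)`
  have hAc : Continuous (autocorrAt b f) := continuous_weilConv_weilReflect_cutoff hfc b
  have hAs : HasCompactSupport (autocorrAt b f) := hasCompactSupport_weilConv_weilReflect_cutoff f b
  have hAA := integrable_weilArchIntegrand_autocorrAt hf hf' hb
  have hW : Tendsto (fun k ↦ weilQuadratic (weilConv (cutoffAt b f) (moll k))) atTop
      (𝓝 (weilFunctional (autocorrAt b f))) := by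
    refine (tendsto_weilFunctional_mollSq hAc hAs hAA).congr fun k ↦ ?_
    exact (weilQuadratic_weilConv_moll hGm hGi hGs hGM k).symm
  -- support radius: from `k₀` on, `supp (G_b ⋆ φ_k) ⊆ [-a, a]`
  obtain ⟨k₀, hk₀⟩ : ∃ k₀ : ℕ, ∀ k ≥ k₀, (bump k).rOut < a - b :=
    eventually_atTop.1 ((tendsto_order.1 tendsto_bump_rOut).2 _ (by linarith))
  set g : ℕ → ℝ → ℂ := fun k ↦ weilConv (cutoffAt b f) (moll (k + k₀)) with hg
  have hT : ∀ k, IsWeilTest (g k) := fun k ↦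
    isWeilTest_weilConv_moll_of_locallyIntegrable hGi.locallyIntegrable hGs _
  have hsupp : ∀ k, tsupport (g k) ⊆ Icc (-a) a := by
    intro k
    have hr := hk₀ (k + k₀) (Nat.le_add_left k₀ k)
    exact (tsupport_weilConv_moll_subset hGR (k + k₀)).trans
      (Icc_subset_Icc (by linarith) (by linarith))
  have hgz : ∀ k x, x ∉ Icc (-a) a → g k x = 0 := fun k x hx ↦
    image_eq_zero_of_notMem_tsupport fun h ↦ hx (hsupp k h)
  -- Bombieri on the smooth tests
  have hB : ∀ k, (weilQuadratic (g k)).re = markovClosedForm a (g k) := fun k ↦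
    re_weilQuadratic_eq_markovClosedForm (hT k) (hsupp k)
  -- the closed-form engine
  have hGz : ∀ x, x ∉ Icc (-a) a → cutoffAt b f x = 0 := fun x hx ↦
    cutoffAt_eq_zero_of_notMem hba.le f hx
  have hL2 : Tendsto (fun k ↦ ∫ x, ‖g k x - cutoffAt b f x‖ ^ 2) atTop (𝓝 0) :=
    (tendsto_integral_norm_sq_weilConv_moll_sub hGi hGM hGR (ae_continuousAt_cutoffAt hfc b)).comp
      (tendsto_add_atTop_nat k₀)
  have hinc : ∀ k t, 0 < t →
      weilIncrement (g k) t ≤ 2 * max M₀ 0 * (derivMass b f' b + 2 * max M₀ 0) * t :=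
    fun k t ht ↦ weilIncrement_weilConv_moll_cutoffAt_le hf hf' hb hM0 hM le_rfl (k + k₀) ht
  obtain ⟨-, hmcf⟩ := tendsto_markovClosedForm_of_increment_le (memLp_two_cutoffAt hfc b)
    (fun k ↦ (hT k).memLp_two) hGz hgz hL2 hinc
  -- compare the two limits
  have hWre : Tendsto (fun k ↦ (weilQuadratic (g k)).re) atTop
      (𝓝 (weilFunctional (autocorrAt b f)).re) :=
    (continuous_re.tendsto _).comp (hW.comp (tendsto_add_atTop_nat k₀))
  have e : (fun k ↦ (weilQuadratic (g k)).re) = fun k ↦ markovClosedForm a (g k) := funext hB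
  rw [e] at hWre
  exact tendsto_nhds_unique hWre hmcf

/-- **Step (C): the identity at the window radius itself.**  For `0 < a`:
`Re W(A_a) = markovClosedForm a (G_a)`. [folklore] -/
theorem re_weilFunctional_autocorrAt_self_eq_markovClosedForm (hf : ∀ x, HasDerivAt f (f' x) x)
    (hf' : Continuous f') {a : ℝ} (ha : 0 < a) :
    (weilFunctional (autocorrAt a f)).re = markovClosedForm a (cutoffAt a f) := by
  have hfc : Continuous f := continuous_iff_continuousAt.2 fun x ↦ (hf x).continuousAt
  obtain ⟨M₀, hM₀⟩ := isCompact_Icc.exists_bound_of_continuousOn (s := Icc (-a) a) hfc.continuousOn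
  have hM0 : 0 ≤ max M₀ 0 := le_max_right _ _
  have hM : ∀ x ∈ Icc (-a) a, ‖f x‖ ≤ max M₀ 0 := fun x hx ↦ (hM₀ x hx).trans (le_max_left _ _)
  have hbmem : ∀ n, radiusSeq a n ∈ Icc 0 a := radiusSeq_mem ha.le
  have hblt : ∀ n, radiusSeq a n < a := radiusSeq_lt ha
  -- termwise: step (B)
  have hn : ∀ n, (weilFunctional (autocorrAt (radiusSeq a n) f)).re =
      markovClosedForm a (cutoffAt (radiusSeq a n) f) := fun n ↦
    re_weilFunctional_autocorrAt_eq_markovClosedForm hf hf' (hbmem n).1 (hblt n)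
  -- Weil side
  have hWre : Tendsto (fun n ↦ (weilFunctional (autocorrAt (radiusSeq a n) f)).re) atTop
      (𝓝 (weilFunctional (autocorrAt a f)).re) :=
    (continuous_re.tendsto _).comp
      (tendsto_weilFunctional_autocorrAt hf hf' hbmem ⟨ha.le, le_rfl⟩ (tendsto_radiusSeq a))
  -- closed-form side: the engine along the radii
  have hM' : ∀ n, ∀ x ∈ Icc (-radiusSeq a n) (radiusSeq a n), ‖f x‖ ≤ max M₀ 0 := fun n x hx ↦
    hM x ⟨by linarith [(hbmem n).2, hx.1], by linarith [(hbmem n).2, hx.2]⟩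
  have hL2 : Tendsto (fun n ↦ ∫ x, ‖cutoffAt (radiusSeq a n) f x - cutoffAt a f x‖ ^ 2) atTop
      (𝓝 0) := by
    refine squeeze_zero (fun n ↦ integral_nonneg fun x ↦ by positivity)
      (fun n ↦ integral_norm_sq_cutoffAt_sub_le (hbmem n).2 hM) ?_
    have h : Tendsto (fun n ↦ 2 * (a - radiusSeq a n) * max M₀ 0 ^ 2) atTop
        (𝓝 (2 * (a - a) * max M₀ 0 ^ 2)) :=
      ((tendsto_const_nhds.sub (tendsto_radiusSeq a)).const_mul 2).mul_const _
    simpa using h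
  have hinc : ∀ n t, 0 < t → weilIncrement (cutoffAt (radiusSeq a n) f) t ≤
      2 * max M₀ 0 * (derivMass a f' a + 2 * max M₀ 0) * t := fun n t ht ↦
    weilIncrement_cutoffAt_le hf hf' (hbmem n).1 hM0 (hM' n)
      (derivMass_self_mono hf' (hbmem n).1 (hbmem n).2) ht
  obtain ⟨-, hmcf⟩ := tendsto_markovClosedForm_of_increment_le (memLp_two_cutoffAt hfc a)
    (fun n ↦ memLp_two_cutoffAt hfc (radiusSeq a n))
    (fun x hx ↦ cutoffAt_eq_zero_of_notMem le_rfl f hx)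
    (fun n x hx ↦ cutoffAt_eq_zero_of_notMem (hbmem n).2 f hx) hL2 hinc
  have e : (fun n ↦ (weilFunctional (autocorrAt (radiusSeq a n) f)).re) =
      fun n ↦ markovClosedForm a (cutoffAt (radiusSeq a n) f) := funext hn
  rw [e] at hWre
  exact tendsto_nhds_unique hWre hmcf

end ClosedFormEngine

/-! ## The identity at the cut-off profiles, and its by-name consequences -/

/-- **MARKOV IDENTITY AT THE CUT-OFF, PROVED** (typer's `MarkovAtCutoff`,
`Theorems/PfPersistenceTallyTwin.lean`): `Re Q(cutoffProfile win v) = markovClosedForm win.a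
(cutoffProfile win v)` for every window and coefficient vector. [folklore] -/
theorem markovAtCutoff : MarkovAtCutoff := by
  intro win v
  rw [cutoffProfile_eq_indicator win v]
  exact ClosedFormEngine.re_weilFunctional_autocorrAt_self_eq_markovClosedForm
    (hasDerivAt_profileC _ v) (continuous_deriv_profileC _ v) win.ha

/-- **GAL-0 (i) AS TYPED, PROVED:** the window-matrix identity `GalerkinMatrixIdentity`
(`Theorems/PfPersistenceGalerkinFormDomain.lean`) — the quadratic form of `ζ`'s even block IS
`Re Q` of the cut-off profile, and the coefficient norm is its `L²` norm. [folklore] -/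
theorem galerkinMatrixIdentity : GalerkinMatrixIdentity :=
  markovAtCutoff_iff_galerkinMatrixIdentity.1 markovAtCutoff

/- (ii″) by the second route — `testToGalerkinFormDensity_of_markovAtCutoff markovAtCutoff
testToProfileFormDensity : TestToGalerkinFormDensity` — is not restated as a theorem: the
proposition is already landed (cand-3's Fejér route, `testToGalerkinFormDensity`, gate lint
`dedup.landed` p189400); the term above is its Fejér-free proof. -/

end Summit.RiemannHypothesis.RiemannHypothesis.Theorems.PfPersistence
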